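import Summits.HubbardSuperconductivity.HubbardSuperconductivity.Theses.NodalWardXY
import Literature.MathematicalPhysics.QuantumLattice.BdGBondHamiltonianParticleHole

/-!
# Vocabulary of the line `Sketch` (log-determinant transfer) for the crux
# `NodalWardXY.VisonPairCost` (stmt-HubbardSuperconductivity-1266)

Route-posited objects and statements (D-0016: `Theorems/<RouteSlug><Crux>Defs.lean`, reviewed), VERBATIM the
statement block of the checked skeleton `Cruxes/VisonPairCost/Lines/Sketch.lean`, so that the seven registered
stubs of the line, which land as separate `Theorems` files, share one vocabulary and each lands as
`theorem stub_<name> : <registered signature>` importing this file (the gate's `supports.stub-mismatch` rule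
matches name + signature text).  Same idiom as `Theorems/NodalWardXYDefs.lean` (sibling crux `PerturbedXYOrder`)
and `Theorems/NodalWardXYNodalReductionDefs.lean` (sibling crux `NodalReduction`).

The line realises the crux as
`GroundEnergyFormula → LogDetFormula → Ultraviolet → RankWindow → InfraredWindow → CruxBound (↔ VisonPairCost)`:

* `visonH L μ Δ₀ R` is LITERALLY the crux's `H R` (`visonPairCost_iff : VisonPairCost ↔ CruxBound-shape` by
  `Iff.rfl`); `visonHop`, `visonPair` are its bond data spread on ordered site pairs of the fermionic torus and
  `visonNambu := bdgNambuMatrix visonHop visonPair μ` (tree, `BdGBondHamiltonianParticleHole`) its one-body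
  Nambu matrix; `logDetKernel A B t = log‖det(A+it)‖ − log‖det(B+it)‖` is the Matsubara kernel;
* `GroundEnergyFormula` — `E₀(visonH R) = −μL² − ½Σᵢ|λᵢ(visonNambu R)|` (Lieb's partial particle–hole
  transformation; tree `groundEnergy_bdgBondHamiltonian` after the bridge `visonH = bdgBondHamiltonian …`);
* `LogDetFormula` — `Σ|λ(A)| − Σ|λ(B)| = (2/π)∫₀^∞ D_t dt` with integrability (`∫₀^∞ log(1+λ²/t²)dt = π|λ|`);
* `Ultraviolet` — `|D_t| ≤ C/t²` for `t ≥ t₀(μ,Δ₀)`, uniformly in `(L,R)` (moment locality of `Tr N^{2k}`);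
* `RankWindow` — `|D_t − D_a| ≤ 8R log(a/t)`, `0 < t ≤ a` (`rank(N_R − N_0) ≤ 4R`, eigenvalue counting);
* `GaugeMirrorIdentity` — the exact identity `‖det(M₀+V_A+it)‖² = ‖det(M₀+it)‖²‖det(1 + P_A G V_B G' V_A P_A)‖`
  (crux idea `gauge-mirror-logdet`, first lemma) feeding
* `InfraredWindow` — `∫_{1/L}^{t₀}|D_t|dt + L⁻¹|D_{1/L}| ≤ C(μ,Δ₀,t₀)`, the analytic heart (free nodal resolvent
  decay across the string/complement cut);
* `CruxBound` — the body of the crux over `visonH`.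

Nothing is asserted here beyond definitions, one `Iff.rfl`, and the one-line logic
`visonPairCost_of_cruxBound : CruxBound → VisonPairCost` (a registered stub of the line, so that this file lands
under `--supports`).
-/

noncomputable section

-- `Summit.HubbardSuperconductivity.HubbardSuperconductivity.…` is the tree's summit/sub-problem namespace (D-0017).
set_option linter.dupNamespace false

namespace Summit.HubbardSuperconductivity.HubbardSuperconductivity.Theorems.VisonPairCost

open Literature.Probability.LatticeModels Literature.MathematicalPhysics.QuantumLattice
open Summit.HubbardSuperconductivity.HubbardSuperconductivity.Theses.NodalWardXY
open scoped Matrix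

/-! ## Vocabulary (verbatim the statement block of `Cruxes/VisonPairCost/Lines/Sketch.lean`) -/

/-- The Z₂ string field of the crux: `s_R(x,i) = −1` exactly on the `R` vertical bonds `(x, x + e₁)` leaving
the sites `x = (a, 0)`, `0 ≤ a < R`, and `+1` on every other directed bond. -/
def sgn (L : ℕ) (R : ℕ) (x : TorusSite 2 L) (i : Fin 2) : ℝ :=
  if i = 1 ∧ x 1 = 0 ∧ (x 0).val < R then -1 else 1

/-- `visonH L μ Δ₀ R` = the `H R` of the crux, verbatim. -/
def visonH (L : ℕ) [NeZero L] (μ Δ₀ : ℝ) (R : ℕ) :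
    Matrix (Finset (Orb (FermionTorus 2 L))) (Finset (Orb (FermionTorus 2 L))) ℂ :=
  let c : TorusSite 2 L → Fin 2 →
      Matrix (Finset (Orb (FermionTorus 2 L))) (Finset (Orb (FermionTorus 2 L))) ℂ :=
    fun y σ => annihilation (orb (FermionTorus.ofTorusSite y) σ)
  (∑ x : TorusSite 2 L, ∑ i : Fin 2, (if i = 1 ∧ x 1 = 0 ∧ (x 0).val < R then (-1 : ℂ) else 1) •
    ((∑ σ : Fin 2, -((c x σ)ᴴ * c (x + Pi.single i 1) σ + (c (x + Pi.single i 1) σ)ᴴ * c x σ)) +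
      ((Δ₀ * (if i = 0 then (1 : ℝ) else -1) : ℝ) : ℂ) •
        ((c x 0 * c (x + Pi.single i 1) 1 - c x 1 * c (x + Pi.single i 1) 0) +
          (c x 0 * c (x + Pi.single i 1) 1 - c x 1 * c (x + Pi.single i 1) 0)ᴴ))) -
    (μ : ℂ) • totalNumber

/-- The crux `VisonPairCost` is, definitionally, the uniform bound on the ground energies of `visonH`. -/
theorem visonPairCost_iff :
    VisonPairCost ↔
      ∀ μ : ℝ, μ ∈ Set.Ioo (-4 : ℝ) 4 → μ ≠ 0 → ∀ Δ₀ : ℝ, 0 < Δ₀ → ∃ C : ℝ, ∀ (L : ℕ) [NeZero L], 4 ≤ L →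
        ∀ R : ℕ, 2 * R ≤ L → |(visonH L μ Δ₀ R).groundEnergy - (visonH L μ Δ₀ 0).groundEnergy| ≤ C :=
  Iff.rfl

/-- Hopping bond data of `visonH` spread on ordered site pairs of the fermionic torus (`−s_R` on both
orientations of every nearest-neighbour bond). -/
def visonHop (L : ℕ) [NeZero L] (R : ℕ) (u v : FermionTorus 2 L) : ℂ :=
  ((∑ i : Fin 2,
      ((if v.toTorusSite = u.toTorusSite + Pi.single i 1 then -sgn L R u.toTorusSite i else 0) +
        (if u.toTorusSite = v.toTorusSite + Pi.single i 1 then -sgn L R v.toTorusSite i else 0)) : ℝ) : ℂ)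

/-- Singlet pairing bond data of `visonH` on ordered site pairs (`s_R Δ₀ gᵢ` on the forward bond). -/
def visonPair (L : ℕ) [NeZero L] (Δ₀ : ℝ) (R : ℕ) (u v : FermionTorus 2 L) : ℂ :=
  ((∑ i : Fin 2,
      (if v.toTorusSite = u.toTorusSite + Pi.single i 1 then
        sgn L R u.toTorusSite i * (Δ₀ * (if i = 0 then (1 : ℝ) else -1)) else 0) : ℝ) : ℂ)

/-- The one-body Nambu (BdG) matrix of `visonH L μ Δ₀ R` (tree `bdgNambuMatrix` of the spread bond data). -/
def visonNambu (L : ℕ) [NeZero L] (μ Δ₀ : ℝ) (R : ℕ) :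
    Matrix (Orb (FermionTorus 2 L)) (Orb (FermionTorus 2 L)) ℂ :=
  bdgNambuMatrix (visonHop L R) (visonPair L Δ₀ R) μ

/-- The Matsubara log-determinant kernel `D_t = log ‖det(A + it·1)‖ − log ‖det(B + it·1)‖`. -/
def logDetKernel {n : Type*} [Fintype n] [DecidableEq n] (A B : Matrix n n ℂ) (t : ℝ) : ℝ :=
  Real.log ‖(A + ((t : ℂ) * Complex.I) • (1 : Matrix n n ℂ)).det‖ -
    Real.log ‖(B + ((t : ℂ) * Complex.I) • (1 : Matrix n n ℂ)).det‖

/-- (1) **BdG ground-energy formula**: `E₀(visonH R) = −μL² − ½ Σᵢ |λᵢ(visonNambu R)|` for `L ≥ 4`. -/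
def GroundEnergyFormula : Prop :=
  ∀ (L : ℕ) [NeZero L], 4 ≤ L → ∀ (μ Δ₀ : ℝ) (R : ℕ),
    ∃ h : (visonNambu L μ Δ₀ R).IsHermitian,
      (visonH L μ Δ₀ R).groundEnergy = -μ * (L : ℝ) ^ 2 - (∑ i, |h.eigenvalues i|) / 2

/-- (2) **Matsubara log-determinant formula** for Hermitian matrices of equal size, with integrability:
`Σᵢ|λᵢ(A)| − Σᵢ|λᵢ(B)| = (2/π) ∫₀^∞ (log‖det(A+it)‖ − log‖det(B+it)‖) dt`. -/
def LogDetFormula : Prop :=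
  ∀ (n : Type) [Fintype n] [DecidableEq n] (A B : Matrix n n ℂ) (hA : A.IsHermitian) (hB : B.IsHermitian),
    MeasureTheory.IntegrableOn (logDetKernel A B) (Set.Ioi 0) ∧
      ∑ i, |hA.eigenvalues i| - ∑ i, |hB.eigenvalues i| =
        (2 / Real.pi) * ∫ t in Set.Ioi (0 : ℝ), logDetKernel A B t

/-- (3) **Ultraviolet bound**: `|D_t| ≤ C/t²` for `t ≥ t₀ ≥ 1`, uniformly in `L ≥ 4`, `2R ≤ L`. -/
def Ultraviolet : Prop :=
  ∀ μ Δ₀ : ℝ, ∃ t₀ C : ℝ, 1 ≤ t₀ ∧ ∀ (L : ℕ) [NeZero L], 4 ≤ L → ∀ R : ℕ, 2 * R ≤ L →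
    ∀ t : ℝ, t₀ ≤ t → |logDetKernel (visonNambu L μ Δ₀ R) (visonNambu L μ Δ₀ 0) t| ≤ C / t ^ 2

/-- (4) **Rank window**: `|D_t − D_a| ≤ 8R log(a/t)` for `0 < t ≤ a` (`rank(N_R − N_0) ≤ 4R` and the
eigenvalue-counting inequality for finite-rank Hermitian perturbations). -/
def RankWindow : Prop :=
  ∀ (L : ℕ) [NeZero L], 4 ≤ L → ∀ (μ Δ₀ : ℝ) (R : ℕ) (a t : ℝ), 0 < t → t ≤ a →
    |logDetKernel (visonNambu L μ Δ₀ R) (visonNambu L μ Δ₀ 0) t -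
        logDetKernel (visonNambu L μ Δ₀ R) (visonNambu L μ Δ₀ 0) a| ≤ 8 * R * Real.log (a / t)

/-- (5) **Gauge-mirror identity** (exact, finite-dimensional): for Hermitian `M₀`, a `±1` diagonal `U`,
`V = UM₀U − M₀` splitting as `P_A V P_A + P_B V P_B` over disjoint index sets `A, B`, and `t > 0`:
`‖det(M₀ + P_A V P_A + it)‖² = ‖det(M₀ + it)‖² · ‖det(1 + P_A G (P_B V P_B) G' (P_A V P_A) P_A)‖`,
`G = (M₀ + it)⁻¹`, `G' = U G U`. -/
def GaugeMirrorIdentity : Prop :=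
  ∀ (n : Type) [Fintype n] [DecidableEq n] (M₀ : Matrix n n ℂ), M₀.IsHermitian →
    ∀ (ω : n → Bool) (A B : Finset n), Disjoint A B →
      let U : Matrix n n ℂ := Matrix.diagonal fun i => if ω i then (-1 : ℂ) else 1
      let V : Matrix n n ℂ := U * M₀ * U - M₀
      let PA : Matrix n n ℂ := Matrix.diagonal fun i => if i ∈ A then (1 : ℂ) else 0
      let PB : Matrix n n ℂ := Matrix.diagonal fun i => if i ∈ B then (1 : ℂ) else 0
      V = PA * V * PA + PB * V * PB →
        ∀ t : ℝ, 0 < t →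
          let G : Matrix n n ℂ := (M₀ + ((t : ℂ) * Complex.I) • (1 : Matrix n n ℂ))⁻¹
          let G' : Matrix n n ℂ := U * G * U
          ‖(M₀ + PA * V * PA + ((t : ℂ) * Complex.I) • (1 : Matrix n n ℂ)).det‖ ^ 2 =
            ‖(M₀ + ((t : ℂ) * Complex.I) • (1 : Matrix n n ℂ)).det‖ ^ 2 *
              ‖(1 + PA * G * (PB * V * PB) * G' * (PA * V * PA) * PA).det‖

/-- (6) **Infrared window**: `∫_{1/L}^{t₀} |D_t| dt + L⁻¹ |D_{1/L}| ≤ C(μ, Δ₀, t₀)` uniformly in `L ≥ 4`,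
`2R ≤ L` — the analytic heart (free nodal resolvent decay across the string/complement cut). -/
def InfraredWindow : Prop :=
  ∀ μ : ℝ, μ ∈ Set.Ioo (-4 : ℝ) 4 → μ ≠ 0 → ∀ Δ₀ : ℝ, 0 < Δ₀ → ∀ t₀ : ℝ, 1 ≤ t₀ → ∃ C : ℝ,
    ∀ (L : ℕ) [NeZero L], 4 ≤ L → ∀ R : ℕ, 2 * R ≤ L →
      (∫ t in Set.Ioc (1 / (L : ℝ)) t₀, |logDetKernel (visonNambu L μ Δ₀ R) (visonNambu L μ Δ₀ 0) t|) +
        (1 / (L : ℝ)) * |logDetKernel (visonNambu L μ Δ₀ R) (visonNambu L μ Δ₀ 0) (1 / (L : ℝ))| ≤ C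

/-- The body of the crux over `visonH` (the right-hand side of `visonPairCost_iff`), named so that the glue
stub does not itself conclude the route decl. -/
def CruxBound : Prop :=
  ∀ μ : ℝ, μ ∈ Set.Ioo (-4 : ℝ) 4 → μ ≠ 0 → ∀ Δ₀ : ℝ, 0 < Δ₀ → ∃ C : ℝ, ∀ (L : ℕ) [NeZero L], 4 ≤ L →
    ∀ R : ℕ, 2 * R ≤ L → |(visonH L μ Δ₀ R).groundEnergy - (visonH L μ Δ₀ 0).groundEnergy| ≤ C

/-- The crux follows from its body over `visonH` (registered glue target of the line; pure logic). -/
theorem visonPairCost_of_cruxBound : CruxBound → VisonPairCost :=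
  visonPairCost_iff.mpr

end Summit.HubbardSuperconductivity.HubbardSuperconductivity.Theorems.VisonPairCost

end
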